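import Mathlib
import HarnessLib
import Summits.Ventures.LatticeQCDFlow.Scoring.GaussianEnergyViolationModel

/-!
# The error bar of the Creutz check in the Gaussian model: `Var(e^{−ΔH}) = e^{2⟨ΔH⟩} − 1`, between `2⟨ΔH⟩` and `2⟨ΔH⟩ e^{2⟨ΔH⟩}`

HONEST FRAMING: exact (Metropolis-corrected) sampling algorithms for lattice gauge theory;
figures of merit are autocorrelation/cost numbers at stated couplings and volumes; no
continuum-physics claim.

Venture `LatticeQCDFlow` (cell pub-lqcd), sub-topic `Scoring`; FANOUT row 21 (`su3-base`, the HMC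
arms E2 / OBC-HMC: acceptance test (h) of CARD-su3-base §3 asks for `⟨e^{−ΔH}⟩ = 1 ± 2σ`).  NEW WORK
of the cell (placement rule), elementary, over row 2's `Scoring/GaussianEnergyViolationModel`
(`gaussian_creutz_iff`: in the model `ΔH ∼ N(m, v)` Creutz's identity `⟨e^{−ΔH}⟩ = 1` holds iff
`v = 2m`) and Mathlib's `gaussianReal` (`mgf_id_gaussianReal`).  No definition is introduced; nothing
is cited as a fact; no number of ours.

What `σ` should test (h) expect?  In the Creutz-consistent Gaussian model `ΔH ∼ N(m, 2m)`,
`m = ⟨ΔH⟩`, the second moment of the Creutz observable is `⟨e^{−2ΔH}⟩ = e^{−2m + 4m} = e^{2m}`, so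

  `Var(e^{−ΔH}) = e^{2⟨ΔH⟩} − 1`,  `2⟨ΔH⟩ ≤ Var(e^{−ΔH}) ≤ 2⟨ΔH⟩ · e^{2⟨ΔH⟩}`,

and the one-sigma error of the Creutz average over `N` independent trajectories is
`√((e^{2⟨ΔH⟩} − 1)/N) ≈ √(2⟨ΔH⟩/N)` for small `⟨ΔH⟩` — the model's prediction for the `σ` of (h),
with its hypothesis (Gaussian `ΔH`) visible.

## What is proved (`m : ℝ`, `v : ℝ≥0`)

* `gaussian_integral_exp_neg_two_mul` — `∫ e^{−2x} dN(m, v) = e^{−2m + 2v}`;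
* **`gaussian_creutz_second_moment`** — `∫ e^{−2x} dN(m, 2m) = e^{2m}` (`m ≥ 0`);
* **`gaussian_creutz_variance`** — `Var_{N(m,2m)}[e^{−x}] = e^{2m} − 1` (`m ≥ 0`);
* `two_mul_le_gaussian_creutz_variance` (`2m ≤ e^{2m} − 1`),
  `gaussian_creutz_variance_le` (`e^{2m} − 1 ≤ 2m e^{2m}`, every real `m`), `gaussian_creutz_variance_pos`
  (`> 0` for `m > 0`: the check is never noise-free away from `ΔH ≡ 0`).

NOT CLAIMED: that an HMC's `ΔH` is Gaussian; independence of successive trajectories (the `1/N`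
reading needs the autocorrelation of `e^{−ΔH}`, the scorers' business).
-/

namespace Summit.Ventures.LatticeQCDFlow.Scoring

open Real MeasureTheory ProbabilityTheory

/-- `⟨e^{−2ΔH}⟩` in the Gaussian model: `∫ e^{−2x} dN(m, v) = e^{−2m + 2v}`. -/
theorem gaussian_integral_exp_neg_two_mul (m : ℝ) (v : NNReal) :
    ∫ x, Real.exp (-2 * x) ∂gaussianReal m v = Real.exp (-2 * m + 2 * v) := by
  have h := congrFun (mgf_id_gaussianReal (μ := m) (v := v)) (-2)
  simp only [mgf, id_eq] at h
  calc ∫ x, Real.exp (-2 * x) ∂gaussianReal m v = ∫ x, Real.exp ((-2) * x) ∂gaussianReal m v := rfl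
    _ = Real.exp (m * (-2) + v * (-2) ^ 2 / 2) := by rw [← h]
    _ = Real.exp (-2 * m + 2 * v) := by congr 1; ring

/-- **The second moment of the Creutz observable** in the Creutz-consistent model `N(m, 2m)`:
`⟨e^{−2ΔH}⟩ = e^{2m}`. -/
theorem gaussian_creutz_second_moment {m : ℝ} (hm : 0 ≤ m) :
    ∫ x, Real.exp (-2 * x) ∂gaussianReal m (2 * m).toNNReal = Real.exp (2 * m) := by
  rw [gaussian_integral_exp_neg_two_mul, Real.coe_toNNReal _ (by positivity)]
  congr 1; ring

/-- **`Var(e^{−ΔH}) = e^{2⟨ΔH⟩} − 1`** in the Creutz-consistent Gaussian model `ΔH ∼ N(m, 2m)`. -/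
theorem gaussian_creutz_variance {m : ℝ} (hm : 0 ≤ m) :
    variance (fun x => Real.exp (-x)) (gaussianReal m (2 * m).toNNReal) = Real.exp (2 * m) - 1 := by
  have hint2 : Integrable (fun x => Real.exp ((-2) * x)) (gaussianReal m (2 * m).toNNReal) :=
    integrable_exp_mul_gaussianReal (-2)
  have hmeas : AEStronglyMeasurable (fun x : ℝ => Real.exp (-x)) (gaussianReal m (2 * m).toNNReal) :=
    (Real.continuous_exp.comp continuous_neg).aestronglyMeasurable
  have hLp : MemLp (fun x : ℝ => Real.exp (-x)) 2 (gaussianReal m (2 * m).toNNReal) := by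
    rw [memLp_two_iff_integrable_sq hmeas]
    refine hint2.congr (ae_of_all _ fun x => ?_)
    show Real.exp ((-2) * x) = Real.exp (-x) ^ 2
    rw [← Real.exp_nat_mul]; congr 1; push_cast; ring
  rw [variance_eq_sub hLp]
  have hsq : (fun x : ℝ => Real.exp (-x)) ^ 2 = fun x => Real.exp (-2 * x) := by
    funext x
    simp only [Pi.pow_apply]
    rw [← Real.exp_nat_mul]; congr 1; push_cast; ring
  rw [hsq, gaussian_creutz_second_moment hm, gaussian_creutz hm, one_pow]

/-- `2⟨ΔH⟩ ≤ Var(e^{−ΔH})` in the model (`e^{x} ≥ 1 + x`). -/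
theorem two_mul_le_gaussian_creutz_variance (m : ℝ) : 2 * m ≤ Real.exp (2 * m) - 1 := by
  linarith [Real.add_one_le_exp (2 * m)]

/-- `Var(e^{−ΔH}) ≤ 2⟨ΔH⟩ e^{2⟨ΔH⟩}` in the model (`1 − e^{−x} ≤ x`). -/
theorem gaussian_creutz_variance_le (m : ℝ) :
    Real.exp (2 * m) - 1 ≤ 2 * m * Real.exp (2 * m) := by
  have h := Real.add_one_le_exp (-(2 * m))
  have hpos := Real.exp_pos (2 * m)
  have hprod : Real.exp (-(2 * m)) * Real.exp (2 * m) = 1 := by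
    rw [← Real.exp_add, neg_add_cancel, Real.exp_zero]
  nlinarith [mul_le_mul_of_nonneg_right h hpos.le]

/-- The check is never noise-free in the model away from `ΔH ≡ 0`: `Var(e^{−ΔH}) > 0` for `m > 0`. -/
theorem gaussian_creutz_variance_pos {m : ℝ} (hm : 0 < m) : 0 < Real.exp (2 * m) - 1 := by
  have : 1 < Real.exp (2 * m) := Real.one_lt_exp_iff.mpr (by linarith)
  linarith

end Summit.Ventures.LatticeQCDFlow.Scoring
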